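import Summits.QuantumFields.YangMills.Theorems.HyperbolicRegulatorCurvatureAnchorRStubInstantiateHelpers

/-!
# Route `HyperbolicRegulator`, crux `CurvatureAnchorR` (stmt-QuantumFields-18155), line `witten_hessian`:
# the registered stub `stub_instantiate` (measure-theoretic interface)

Stub file of the checked skeleton `Cruxes/CurvatureAnchorR/Lines/witten_hessian.lean` (lead
`prover-line-stmt-QuantumFields-18155-0`).  It proves the registered stub `stub_instantiate` BY NAME with its registered
signature: for every admissible family (`AdmR`, the crux's `(Fam k j …).1`) and every `(c, k, β, K)`, contractible-support
exponential mixing at rate `c/k` with constant `K` for all `j ≥ k` (the conclusion of the analytic stub `stub_mixing`, here a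
hypothesis) implies the crux's clustering predicate `(Fam k j …).2 β (c/k) C A B` for all `YMSpecies` `A`, `B` of support
radius `≤ ⌊k/8⌋`, with `C := (max K 0 + 2)·M_A·M_B·e^{2c}` (`M_A`, `M_B` the bounds of `A.F`, `B.F`) and `j₀ := k`.

Proof (no analysis, `instantiate_explicit`): the shared `let`-vocabulary of the crux (`Γ, PE, ν, v, w, S, P, X, …`) is
introduced as named local definitions; (1) the link variables `v U l` are continuous and measurable, the Wilson weight `S`
is continuous on the compact configuration space `↥PE → G` (second countable because `r` is a faithful continuous matrix
representation), so `exp (β S)` is a bounded integrable density of positive mass for the product Haar probability measure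
`ν` and `X` is a genuine Gibbs ratio: `|X (f g) − X f · X g| ≤ 2 ‖f‖∞ ‖g‖∞`; (2) the chart-read observable
`U ↦ A.F (P x x′ U)` at C′-flat base points is measurable (`A.measurable`, measurability of `P`) and a cylinder function
of the links within graph distance `⌊k/2⌋` of `x` (first factor) and `x′` (second factor): a support point `p` with
`|p i| ≤ ⌊k/8⌋` is read in the chart box of radius `⌊k/4⌋`, and the chart walk `AdmR.chart_dist_le` /
`AdmR.chart_edge_near` (helpers file) puts the read vertex / edge within `2⌊k/8⌋ + 1 ≤ ⌊k/2⌋` of the centre; (3) far pairs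
(`2k < dist x y + dist x′ y′`) are the mixing hypothesis verbatim, near pairs are covered by (1) since then
`(c/k)(dist + dist′) ≤ 2c`.

References: the route file `Theses/HyperbolicRegulator.lean` (crux `CurvatureAnchorR`), the skeleton
`Cruxes/CurvatureAnchorR/Lines/witten_hessian.lean`, the vocabulary file `Theorems/HyperbolicRegulatorCurvatureAnchorRDefs.lean`
(p172347) and the helpers file `Theorems/HyperbolicRegulatorCurvatureAnchorRStubInstantiateHelpers.lean`.  Everything here is
folklore measure theory; no published theorem is restated.
-/

set_option autoImplicit false

noncomputable section

namespace Summit.QuantumFields.YangMills.Cruxes.CurvatureAnchorR.WittenHessian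

open scoped BigOperators Topology Manifold Classical MeasureTheory ProbabilityTheory Matrix InnerProductSpace ComplexConjugate ContinuousMap
open Filter Set Function TopologicalSpace MeasureTheory
open Literature.MathematicalPhysics.QuantumFieldTheory Literature.MathematicalPhysics.QuantumLattice
open Summit.QuantumFields.YangMills.Theses.HyperbolicRegulator
open Summit.QuantumFields.YangMills.Cruxes.HyperbolicToTorus.NoAdmissibleComplex (InBox)

/-- Box bookkeeping for a support point read at radius `⌊k/8⌋` (`8 ≤ k`): the point `(s, t)` and its two unit steps lie
in the chart box of radius `⌊k/4⌋`, and `|s| + |t| (+ 1) ≤ ⌊k/2⌋`. -/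
theorem box_of_supp {k : ℕ} (hk : 8 ≤ k) {s t : ℤ} (hs : |s| ≤ ((k / 8 : ℕ) : ℤ)) (ht : |t| ≤ ((k / 8 : ℕ) : ℤ)) :
    InBox ((k : ℤ) / 4) (s, t) ∧
      (∀ μ : Fin 2, InBox ((k : ℤ) / 4) (if μ = 0 then (s + 1, t) else (s, t + 1))) ∧
        |s| + |t| ≤ ((k / 2 : ℕ) : ℤ) ∧ |s| + |t| + 1 ≤ ((k / 2 : ℕ) : ℤ) := by
  refine ⟨⟨?_, ?_⟩, fun μ => inBox_step (a := (s, t)) ?_ ?_ μ, ?_, ?_⟩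
  · show |s| ≤ (k : ℤ) / 4
    omega
  · show |t| ≤ (k : ℤ) / 4
    omega
  · show |s| + 1 ≤ (k : ℤ) / 4
    omega
  · show |t| + 1 ≤ (k : ℤ) / 4
    omega
  · omega
  · omega

/-- **`stub_instantiate` over explicit parameters.**  For ONE admissible complex (`AdmR k j …`, `8 ≤ k`), a rate constant
`c > 0`, bounds `M_A`, `M_B` of two `YMSpecies` `A`, `B` of support radius `≤ ⌊k/8⌋`, and — inside the crux's shared
`let`-vocabulary `Γ, dg, K, F, Ed, PE, Cfg, ν, v, w, S, d0, P` (verbatim `Fam`'s) and `nr, Cyl, X` (verbatim `Mix`'s) — the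
contractible-support mixing hypothesis at `(β, c/k, K)`: the crux's clustering inequality at every quadruple of C′-flat base
points with constant `(max K 0 + 2)·M_A·M_B·e^{2c}`.  The `let`s are byte-identical to the registered statement, so the stub
follows by `ζ`-reduction. -/
theorem instantiate_explicit (G : Type) [Group G] [TopologicalSpace G] [IsTopologicalGroup G] [CompactSpace G]
    [MeasurableSpace G] [BorelSpace G] (r : LatticeRep G) (k j : ℕ) (V E Q : Finset ℕ) (σ τ : ℕ → ℕ)
    (bd : ℕ → Fin 4 → ℕ × Bool) (cV : ℕ → ℤ × ℤ → ℕ) (cE : ℕ → ℤ × ℤ → Fin 2 → ℕ × Bool)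
    (β c Kc MA MB : ℝ) (A B : YMSpecies G) (hk : 8 ≤ k) (hc : 0 < c) (hAdm : AdmR k j V E Q σ τ bd cV cE)
    (hA : ∀ p ∈ A.supp, ∀ i, |p.1 i| ≤ ((k / 8 : ℕ) : ℤ)) (hB : ∀ p ∈ B.supp, ∀ i, |p.1 i| ≤ ((k / 8 : ℕ) : ℤ))
    (hMA : ∀ U, |A.F U| ≤ MA) (hMB : ∀ U, |B.F U| ≤ MB) :
    let Γ := SimpleGraph.fromRel fun a b : ℕ => ∃ e ∈ E, σ e = a ∧ τ e = b; let dg := fun x : ℕ => (E.filter fun e => σ e = x ∨ τ e = x).card; let K := V.filter fun x => dg x = 5; let F := fun x : ℕ => x ∈ V ∧ ∀ c ∈ K, k / 2 < Γ.dist x c; let Ed := (ℕ × ℕ) ⊕ (ℕ × ℕ); let PE : Finset Ed := (E ×ˢ V).disjSum (V ×ˢ E); let Cfg := ↥PE → G; let ν := Measure.pi fun _ : ↥PE => haarProbability G; let v := fun (U : Cfg) (e : Ed × Bool) => if h : e.1 ∈ PE then (if e.2 then U ⟨e.1, h⟩ else (U ⟨e.1, h⟩)⁻¹) else 1; let w :=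 fun (U : Cfg) (e : Fin 4 → Ed × Bool) => (r.ρ (v U (e 0) * v U (e 1) * v U (e 2) * v U (e 3))).trace.re; let S := fun U : Cfg => (∑ q ∈ Q, ∑ y ∈ V, w U fun i => (Sum.inl ((bd q i).1, y), (bd q i).2)) + (∑ y ∈ V, ∑ q ∈ Q, w U fun i => (Sum.inr (y, (bd q i).1), (bd q i).2)) + ∑ e ∈ E, ∑ e' ∈ E, w U ![(Sum.inl (e, σ e'), true), (Sum.inr (τ e, e'), true), (Sum.inl (e, τ e'), false), (Sum.inr (σ e, e'), false)]; let d0 : Fin 4 → Fin 2 := ![0, 1, 0, 1]; let P := fun (x x' : ℕ) (U : Cfg) (p : ZdEdge 4) => let a := (p.1 0, p.1 1); let b := (p.1 2, p.1 3); if p.2 = 0 ∨ p.2 = 1 then v U (Sum.inl ((cE x a (d0 p.2)).1, cV x' b), (cE x a (d0 p.2)).2) else v U (Sum.inr (cV x a, (cE x' b (d0 p.2)).1), (cE x' b (d0 p.2)).2); let nr := fun (a b : ℕ) (l : Ed) => Sum.elim (fun p : ℕ × ℕ => Γ.dist a (σ p.1) ≤ k / 2 ∧ Γ.dist a (τ p.1)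 ≤ k / 2 ∧ Γ.dist b p.2 ≤ k / 2) (fun p : ℕ × ℕ => Γ.dist a p.1 ≤ k / 2 ∧ Γ.dist b (σ p.2) ≤ k / 2 ∧ Γ.dist b (τ p.2) ≤ k / 2) l; let Cyl := fun (a b : ℕ) (f : Cfg → ℝ) => ∀ U U' : Cfg, (∀ (l : Ed) (h : l ∈ PE), nr a b l → U ⟨l, h⟩ = U' ⟨l, h⟩) → f U = f U'; let X := fun f : Cfg → ℝ => (∫ U, f U * Real.exp (β * S U) ∂ν) / (∫ U, Real.exp (β * S U) ∂ν); (∀ (a b a' b' : ℕ) (f g : Cfg → ℝ) (Mf Mg : ℝ), a ∈ V → b ∈ V → a' ∈ V → b' ∈ V → Cyl a b f → Cyl a' b' g → Measurable f → Measurable g → (∀ U, |f U| ≤ Mf) → (∀ U, |g U| ≤ Mg) → 2 * k < Γ.dist a a' + Γ.dist b b' → |X (fun U => f U * g U) - X f * X g| ≤ Kc * Mf * Mg * Real.exp (-(c / k * ((Γ.dist a a' + Γ.dist b b' : ℕ) : ℝ)))) → ∀ x x' y y', F x → F x' → F y → F y' → |X (fun U => A.F (P x x' U) * B.F (P y y'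 U)) - X (fun U => A.F (P x x' U)) * X (fun U => B.F (P y y' U))| ≤ (max Kc 0 + 2) * MA * MB * Real.exp (2 * c) * Real.exp (-(c / k * ((Γ.dist x y + Γ.dist x' y' : ℕ) : ℝ))) := by
  intro Γ dg K F Ed PE Cfg ν v w S d0 P nr Cyl X hMix x x' y y' hx hx' hy hy'
  haveI : SecondCountableTopology G := secondCountable_of_latticeRep r
  obtain ⟨-, -, hk0⟩ := support_arith k hk
  -- §A the link variables and the plaquette weights (this consumes the values of `v` and `w`)
  have hvC : ∀ e : Ed × Bool, Continuous fun U : Cfg => v U e := fun e => continuous_linkVar PE e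
  have hvM : ∀ e : Ed × Bool, Measurable fun U : Cfg => v U e := fun e => measurable_linkVar PE e
  have hveq : ∀ (U U' : Cfg) (a b : ℕ), (∀ (l : Ed) (h : l ∈ PE), nr a b l → U ⟨l, h⟩ = U' ⟨l, h⟩) →
      ∀ e : Ed × Bool, nr a b e.1 → v U e = v U' e := by
    intro U U' a b hUU' e he
    by_cases h : e.1 ∈ PE
    · simp only [v, dif_pos h]
      rw [hUU' e.1 h he]
    · simp only [v, dif_neg h]
  have hwC : ∀ e : Fin 4 → Ed × Bool, Continuous fun U : Cfg => w U e := fun e =>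
    (continuous_trace_re_rep r).comp ((((hvC (e 0)).mul (hvC (e 1))).mul (hvC (e 2))).mul (hvC (e 3)))
  clear_value v w
  -- §B the action is continuous, so `exp (β S)` is an admissible density
  have hS1 : Continuous fun U : Cfg => ∑ q ∈ Q, ∑ y ∈ V, w U fun i => (Sum.inl ((bd q i).1, y), (bd q i).2) :=
    continuous_finsetSum Q fun q _ => continuous_finsetSum V fun y _ =>
      hwC fun i => (Sum.inl ((bd q i).1, y), (bd q i).2)
  have hS2 : Continuous fun U : Cfg => ∑ y ∈ V, ∑ q ∈ Q, w U fun i => (Sum.inr (y, (bd q i).1), (bd q i).2) :=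
    continuous_finsetSum V fun y _ => continuous_finsetSum Q fun q _ =>
      hwC fun i => (Sum.inr (y, (bd q i).1), (bd q i).2)
  have hS3 : Continuous fun U : Cfg => ∑ e ∈ E, ∑ e' ∈ E, w U ![(Sum.inl (e, σ e'), true),
      (Sum.inr (τ e, e'), true), (Sum.inl (e, τ e'), false), (Sum.inr (σ e, e'), false)] :=
    continuous_finsetSum E fun e _ => continuous_finsetSum E fun e' _ =>
      hwC ![(Sum.inl (e, σ e'), true), (Sum.inr (τ e, e'), true), (Sum.inl (e, τ e'), false),
        (Sum.inr (σ e, e'), false)]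
  have hS : Continuous S := (hS1.add hS2).add hS3
  obtain ⟨hρ0, hρi, hZ⟩ := density_exp_admissible (ν := ν) hS β
  -- §C the chart-read observables: measurable, bounded, cylinder
  have hPM : ∀ z z' : ℕ, Measurable fun U : Cfg => P z z' U := by
    intro z z'
    refine measurable_pi_lambda _ fun p => ?_
    by_cases hc2 : p.2 = 0 ∨ p.2 = 1
    · simp only [P, if_pos hc2]
      exact hvM _
    · simp only [P, if_neg hc2]
      exact hvM _
  have hMA0 : 0 ≤ MA := (abs_nonneg _).trans (hMA fun _ => 1)
  have hMB0 : 0 ≤ MB := (abs_nonneg _).trans (hMB fun _ => 1)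
  have hCyl : ∀ (O : YMSpecies G) (z z' : ℕ), (∀ p ∈ O.supp, ∀ i, |p.1 i| ≤ ((k / 8 : ℕ) : ℤ)) →
      F z → F z' → Cyl z z' (fun U => O.F (P z z' U)) := by
    intro O z z' hO hz hz' U U' hUU'
    apply O.isCylinder
    intro p hp
    have hp' := hO p (Finset.mem_coe.mp hp)
    obtain ⟨ha, ha', hna, hna'⟩ := box_of_supp hk (hp' 0) (hp' 1)
    obtain ⟨hb, hb', hnb, hnb'⟩ := box_of_supp hk (hp' 2) (hp' 3)
    have hda : Γ.dist z (cV z (p.1 0, p.1 1)) ≤ k / 2 := hAdm.chart_dist_le hz (k / 2) _ ha hna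
    have hdb : Γ.dist z' (cV z' (p.1 2, p.1 3)) ≤ k / 2 := hAdm.chart_dist_le hz' (k / 2) _ hb hnb
    have hea : ∀ μ : Fin 2, Γ.dist z (σ (cE z (p.1 0, p.1 1) μ).1) ≤ k / 2 ∧
        Γ.dist z (τ (cE z (p.1 0, p.1 1) μ).1) ≤ k / 2 := fun μ =>
      (hAdm.chart_edge_near hz (k / 2) _ μ ha (ha' μ) hna').2
    have heb : ∀ μ : Fin 2, Γ.dist z' (σ (cE z' (p.1 2, p.1 3) μ).1) ≤ k / 2 ∧
        Γ.dist z' (τ (cE z' (p.1 2, p.1 3) μ).1) ≤ k / 2 := fun μ =>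
      (hAdm.chart_edge_near hz' (k / 2) _ μ hb (hb' μ) hnb').2
    by_cases hc2 : p.2 = 0 ∨ p.2 = 1
    · simp only [P, if_pos hc2]
      refine hveq U U' z z' hUU' _ ?_
      simp only [nr, Sum.elim_inl]
      exact ⟨(hea _).1, (hea _).2, hdb⟩
    · simp only [P, if_neg hc2]
      refine hveq U U' z z' hUU' _ ?_
      simp only [nr, Sum.elim_inr]
      exact ⟨hda, (heb _).1, (heb _).2⟩
  have hfM : Measurable fun U : Cfg => A.F (P x x' U) := A.measurable.comp (hPM x x')
  have hgM : Measurable fun U : Cfg => B.F (P y y' U) := B.measurable.comp (hPM y y')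
  -- §D far pairs: the mixing hypothesis; near pairs: boundedness
  by_cases hfar : 2 * k < Γ.dist x y + Γ.dist x' y'
  · have hM := hMix x x' y y' (fun U => A.F (P x x' U)) (fun U => B.F (P y y' U)) MA MB hx.1 hx'.1 hy.1
      hy'.1 (hCyl A x x' hA hx hx') (hCyl B y y' hB hy hy') hfM hgM (fun U => hMA _) (fun U => hMB _) hfar
    exact hM.trans (far_const_le hMA0 hMB0 (Real.exp_pos _).le hc.le)
  · have hnear : Γ.dist x y + Γ.dist x' y' ≤ 2 * k := Nat.le_of_not_lt hfar
    have hcov := abs_gibbsCov_le (ν := ν) (f := fun U => A.F (P x x' U)) (g := fun U => B.F (P y y' U))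
      hρ0 hρi hZ (fun U => hMA _) (fun U => hMB _) hMA0
    exact hcov.trans (near_const_le (Kc := Kc) hMA0 hMB0 (rate_near hc.le hk0 hnear))


/-- **Stub I — INSTANTIATION TO THE CRUX FUNCTIONAL (measure-theoretic interface; registered stub of the line
`witten_hessian`, proved).**  For every admissible family and every `(c, k, β, K)`: contractible-support mixing at rate `c/k`
with constant `K` for all `j ≥ k` implies the crux's clustering predicate `(Fam k j …).2 β (c/k) C A B` for all `YMSpecies`
`A, B` of support radius `≤ ⌊k/8⌋`, with `C := (max K 0 + 2)·M_A·M_B·e^{2c}` (`A.bounded`, `B.bounded`) and `j₀ := k`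
(`instantiate_explicit` at the `j`-th complex; the `letI` Borel structure is re-installed as a local instance). -/
theorem stub_instantiate :
    open Literature.MathematicalPhysics.QuantumFieldTheory Literature.MathematicalPhysics.QuantumLattice MeasureTheory in ∀ (G : Type) [Group G] [TopologicalSpace G] [IsTopologicalGroup G] [CompactSpace G], IsCompactSimpleLieGroup G → letI : MeasurableSpace G := borel G; haveI : BorelSpace G := ⟨rfl⟩; ∀ r : LatticeRep G, let Fam := fun (k j : ℕ) (V E Q : Finset ℕ) (σ τ : ℕ → ℕ) (bd : ℕ → Fin 4 → ℕ × Bool) (cV : ℕ → ℤ × ℤ → ℕ) (cE : ℕ → ℤ × ℤ → Fin 2 → ℕ × Bool) => let st := fun e : ℕ × Bool => if e.2 then σ e.1 else τ e.1; let en := fun e : ℕ × Bool => if e.2 then τ e.1 else σ e.1; let Γ := SimpleGraph.fromRel fun a b : ℕ => ∃ e ∈ E, σ e = a ∧ τ e = b; let dg := fun x : ℕ => (E.filter fun e => σ e = x ∨ τ e = x).card; let K := V.filter fun x => dg x = 5; let F := fun x : ℕ => x ∈ V ∧ ∀ c ∈ K, k / 2 < Γ.dist x c; let Dp := fun x : ℕ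 => x ∈ V ∧ ∀ c ∈ K, 3 * (k / 4) < Γ.dist x c; let ib := fun a : ℤ × ℤ => |a.1| ≤ (k : ℤ) / 4 ∧ |a.2| ≤ (k : ℤ) / 4; let nx := fun (a : ℤ × ℤ) (μ : Fin 2) => if μ = 0 then (a.1 + 1, a.2) else (a.1, a.2 + 1); let Ed := (ℕ × ℕ) ⊕ (ℕ × ℕ); let PE : Finset Ed := (E ×ˢ V).disjSum (V ×ˢ E); let Cfg := ↥PE → G; let ν := Measure.pi fun _ : ↥PE => haarProbability G; let v := fun (U : Cfg) (e : Ed × Bool) => if h : e.1 ∈ PE then (if e.2 then U ⟨e.1, h⟩ else (U ⟨e.1, h⟩)⁻¹) else 1; let w := fun (U : Cfg) (e : Fin 4 → Ed × Bool) => (r.ρ (v U (e 0) * v U (e 1) * v U (e 2) * v U (e 3))).trace.re; let S := fun U : Cfg => (∑ q ∈ Q, ∑ y ∈ V, w U fun i => (Sum.inl ((bd q i).1, y), (bd q i).2)) + (∑ y ∈ V, ∑ q ∈ Q, w U fun i => (Sum.inr (y, (bd q i).1), (bd q i).2)) + ∑ e ∈ E, ∑ e' ∈ E, w U ![(Sum.inl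 (e, σ e'), true), (Sum.inr (τ e, e'), true), (Sum.inl (e, τ e'), false), (Sum.inr (σ e, e'), false)]; let d0 : Fin 4 → Fin 2 := ![0, 1, 0, 1]; let P := fun (x x' : ℕ) (U : Cfg) (p : ZdEdge 4) => let a := (p.1 0, p.1 1); let b := (p.1 2, p.1 3); if p.2 = 0 ∨ p.2 = 1 then v U (Sum.inl ((cE x a (d0 p.2)).1, cV x' b), (cE x a (d0 p.2)).2) else v U (Sum.inr (cV x a, (cE x' b (d0 p.2)).1), (cE x' b (d0 p.2)).2); ((∀ e ∈ E, σ e ∈ V ∧ τ e ∈ V ∧ σ e ≠ τ e) ∧ (∀ q ∈ Q, (∀ i, (bd q i).1 ∈ E) ∧ (∀ i, en (bd q i) = st (bd q (i + 1))) ∧ (st ∘ bd q).Injective) ∧ (∀ e ∈ E, (Q.filter fun q => ∃ i, (bd q i).1 = e).card = 2) ∧ (∀ x ∈ V, (dg x = 4 ∨ dg x = 5) ∧ (Q.filter fun q => ∃ i, st (bd q i) = x).card = dg x) ∧ (∀ x ∈ V, ∃ c ∈ K, Γ.dist x c ≤ k) ∧ (∀ c ∈ K, ∀ c' ∈ K,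 c ≠ c' → k ≤ Γ.dist c c') ∧ (∀ f : ℕ → ℝ, ∑ x ∈ V, f x = 0 → ∑ x ∈ V, f x ^ 2 ≤ 10 ^ 6 * (k : ℝ) ^ 2 * ∑ e ∈ E, (f (σ e) - f (τ e)) ^ 2) ∧ (∃ x y, Dp x ∧ Dp y ∧ j ≤ Γ.dist x y) ∧ (∀ x, F x → cV x (0, 0) = x ∧ (∀ a, ib a → cV x a ∈ V) ∧ Set.InjOn (cV x) {a | ib a} ∧ (∀ a μ, ib a → ib (nx a μ) → (cE x a μ).1 ∈ E ∧ st (cE x a μ) = cV x a ∧ en (cE x a μ) = cV x (nx a μ)) ∧ (∀ a, ib a → ib (a.1 + 1, a.2 + 1) → ∃ q ∈ Q, Finset.univ.image (Prod.fst ∘ bd q) = {(cE x a 0).1, (cE x (nx a 0) 1).1, (cE x (nx a 1) 0).1, (cE x a 1).1})), fun (β m C : ℝ) (A B : YMSpecies G) => let X := fun f : Cfg → ℝ => (∫ U, f U * Real.exp (β * S U) ∂ν) / (∫ U, Real.exp (β * S U) ∂ν); ∀ x x' y y', F x → F x' → F y → F y' → |X (fun U => A.F (P x x' U) * B.F (P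 y y' U)) - X (fun U => A.F (P x x' U)) * X (fun U => B.F (P y y' U))| ≤ C * Real.exp (-(m * ((Γ.dist x y + Γ.dist x' y' : ℕ) : ℝ)))); let Sp := fun (A : YMSpecies G) (R : ℕ) => ∀ p ∈ A.supp, ∀ i, |p.1 i| ≤ (R : ℤ); let Mix := fun (k : ℕ) (V E Q : Finset ℕ) (σ τ : ℕ → ℕ) (bd : ℕ → Fin 4 → ℕ × Bool) => let Γ := SimpleGraph.fromRel fun a b : ℕ => ∃ e ∈ E, σ e = a ∧ τ e = b; let Ed := (ℕ × ℕ) ⊕ (ℕ × ℕ); let PE : Finset Ed := (E ×ˢ V).disjSum (V ×ˢ E); let Cfg := ↥PE → G; let ν := Measure.pi fun _ : ↥PE => haarProbability G; let v := fun (U : Cfg) (e : Ed × Bool) => if h : e.1 ∈ PE then (if e.2 then U ⟨e.1, h⟩ else (U ⟨e.1, h⟩)⁻¹) else 1; let w := fun (U : Cfg) (e : Fin 4 → Ed × Bool) => (r.ρ (v U (e 0) * v U (e 1) * v U (e 2) * v U (e 3))).trace.re; let S := fun U : Cfg => (∑ q ∈ Q, ∑ y ∈ V, w U fun i => (Sum.inl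 ((bd q i).1, y), (bd q i).2)) + (∑ y ∈ V, ∑ q ∈ Q, w U fun i => (Sum.inr (y, (bd q i).1), (bd q i).2)) + ∑ e ∈ E, ∑ e' ∈ E, w U ![(Sum.inl (e, σ e'), true), (Sum.inr (τ e, e'), true), (Sum.inl (e, τ e'), false), (Sum.inr (σ e, e'), false)]; let nr := fun (a b : ℕ) (l : Ed) => Sum.elim (fun p : ℕ × ℕ => Γ.dist a (σ p.1) ≤ k / 2 ∧ Γ.dist a (τ p.1) ≤ k / 2 ∧ Γ.dist b p.2 ≤ k / 2) (fun p : ℕ × ℕ => Γ.dist a p.1 ≤ k / 2 ∧ Γ.dist b (σ p.2) ≤ k / 2 ∧ Γ.dist b (τ p.2) ≤ k / 2) l; let Cyl := fun (a b : ℕ) (f : Cfg → ℝ) => ∀ U U' : Cfg, (∀ (l : Ed) (h : l ∈ PE), nr a b l → U ⟨l, h⟩ = U' ⟨l, h⟩) → f U = f U'; fun (β m Kc : ℝ) => let X := fun f : Cfg → ℝ => (∫ U, f U * Real.exp (β * S U) ∂ν) / (∫ U, Real.exp (β * S U) ∂ν); ∀ (a b a' b' : ℕ) (f g : Cfg → ℝ)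 (Mf Mg : ℝ), a ∈ V → b ∈ V → a' ∈ V → b' ∈ V → Cyl a b f → Cyl a' b' g → Measurable f → Measurable g → (∀ U, |f U| ≤ Mf) → (∀ U, |g U| ≤ Mg) → 2 * k < Γ.dist a a' + Γ.dist b b' → |X (fun U => f U * g U) - X f * X g| ≤ Kc * Mf * Mg * Real.exp (-(m * ((Γ.dist a a' + Γ.dist b b' : ℕ) : ℝ))); ∀ (V E Q : ℕ → ℕ → Finset ℕ) (σ τ : ℕ → ℕ → ℕ → ℕ) (bd : ℕ → ℕ → ℕ → Fin 4 → ℕ × Bool) (cV : ℕ → ℕ → ℕ → ℤ × ℤ → ℕ) (cE : ℕ → ℕ → ℕ → ℤ × ℤ → Fin 2 → ℕ × Bool), let Φ := fun k j => Fam k j (V k j) (E k j) (Q k j) (σ k j) (τ k j) (bd k j) (cV k j) (cE k j); let Ψ := fun k j => Mix k (V k j) (E k j) (Q k j) (σ k j) (τ k j) (bd k j); (∀ k j, 8 ≤ k → (Φ k j).1) → ∀ (c : ℝ) (k : ℕ) (β Kc : ℝ), 0 < c → 8 ≤ k → (∀ j, k ≤ j → Ψ k j β (c / k) Kc) → ∀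 A B : YMSpecies G, Sp A (k / 8) → Sp B (k / 8) → ∃ C j₀, ∀ j, j₀ ≤ j → (Φ k j).2 β (c / k) C A B := by
  intro G _ _ _ _ _hG r
  letI : MeasurableSpace G := borel G
  haveI : BorelSpace G := ⟨rfl⟩
  intro Fam Sp Mix V E Q σ τ bd cV cE Φ Ψ hAdm c k β Kc hc hk hMix A B hA hB
  obtain ⟨MA, hMA⟩ := A.bounded
  obtain ⟨MB, hMB⟩ := B.bounded
  exact ⟨(max Kc 0 + 2) * MA * MB * Real.exp (2 * c), k, fun j hj =>
    instantiate_explicit G r k j (V k j) (E k j) (Q k j) (σ k j) (τ k j) (bd k j) (cV k j) (cE k j) β c Kc MA MB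
      A B hk hc (hAdm k j hk) hA hB hMA hMB (hMix j hj)⟩

end Summit.QuantumFields.YangMills.Cruxes.CurvatureAnchorR.WittenHessian

end
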